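import Summits.ResolutionOfSingularities.ResolutionOfSingularities.Theorems.FrobeniusClosingSteerCylinderConcl
import HarnessLib

/-!
# Steer (W4.1): `Concl` of a cylinder datum — the form with the sub-datum inside `K`

OURS (campaign res-hironaka, rung L, slot W4.1, crux `Steer` stmt-ResolutionOfSingularities-16345, line
`switching_dichotomy` r12; res-L0-w41-idea-2's `concl_of_cylinder`; typed and proved by the prover seat res-type-028).
NOT a statement of the manuscript under review; AI-produced, weaker than expert review.

Part 2 of `FrobeniusClosingSteerCylinderConcl.lean`: the consumer-facing corollary `concl_of_cylinder` of the
two-level theorem `concl_of_subdatum`, in which the sub-datum `(B₀, τ)` is given INSIDE `K` and the subfield is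
`L := k(B₀, τ)` (`IntermediateField.adjoin`), the restricted valuation ring being `O ∩ L` (`restrict`).  The
bookkeeping proved here: `O ∩ L = val⁻¹ O` (`mem_restrict_iff`), the pull-back `B₀ ∩ L ≅ B₀` is finitely generated
(`fg_comap_val`), `Frac ((B₀ ∩ L)[τ]) = L` (`isFractionRing_adjoin_comap_val`), and regularity at the centre
transports (`isRegularLocalRing_centre_map_iff` of part 1).
-/

-- single-problem summit: the doubled namespace component `ResolutionOfSingularities` is forced
set_option linter.dupNamespace false

namespace Summit.ResolutionOfSingularities.ResolutionOfSingularities.Theorems.SteerCylinder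

open IsLocalRing
open Literature.AlgebraicGeometry.Resolution
open Summit.ResolutionOfSingularities.ResolutionOfSingularities.Theorems.SteerRankThinness (Concl)

section Subfield

variable {k K : Type} [Field k] [Field K] [Algebra k K]

/-- The restriction `O ∩ L` of a valuation ring `O` of `K` to an intermediate field `L`, as a valuation ring
of `L` (the valuation ring of the restricted valuation). [folklore] -/
noncomputable def restrict (O : ValuationSubring K) (L : IntermediateField k K) : ValuationSubring L :=
  (O.valuation.comap (algebraMap L K)).valuationSubring

/-- `x ∈ O ∩ L ↔ x ∈ O`. [folklore] -/
theorem mem_restrict_iff (O : ValuationSubring K) (L : IntermediateField k K) (x : L) :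
    x ∈ restrict O L ↔ L.val x ∈ O := by
  unfold restrict
  rw [Valuation.mem_valuationSubring_iff, Valuation.comap_apply, ValuationSubring.valuation_le_one_iff]
  rfl

/-- A subalgebra `B₀ ⊆ L` of `K` is the isomorphic image of its pull-back to `L`. [folklore] -/
theorem map_comap_val_eq (L : IntermediateField k K) (B₀ : Subalgebra k K)
    (hB₀L : B₀ ≤ L.toSubalgebra) : (B₀.comap L.val).map L.val = B₀ := by
  rw [Subalgebra.map_comap_eq, IntermediateField.range_val]
  exact inf_eq_left.mpr hB₀L

/-- … with the same underlying set. [folklore] -/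
theorem image_comap_val_eq (L : IntermediateField k K) (B₀ : Subalgebra k K)
    (hB₀L : B₀ ≤ L.toSubalgebra) : L.val '' ((B₀.comap L.val : Subalgebra k L) : Set L) = (B₀ : Set K) := by
  rw [← Subalgebra.coe_map, map_comap_val_eq L B₀ hB₀L]

/-- The pull-back to `L` of a finitely generated subalgebra `B₀ ⊆ L` is finitely generated. [folklore] -/
theorem fg_comap_val (L : IntermediateField k K) (B₀ : Subalgebra k K) (hB₀L : B₀ ≤ L.toSubalgebra)
    (hB₀ : B₀.FG) : (B₀.comap L.val).FG := by
  classical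
  obtain ⟨s, hs⟩ := hB₀
  have hinj : Function.Injective L.val := (L.val : L →+* K).injective
  have hsL : (s : Set K) ⊆ Set.range L.val := fun b hb => by
    have hbL : b ∈ L.toSubalgebra := hB₀L (hs ▸ Algebra.subset_adjoin hb)
    exact ⟨⟨b, hbL⟩, rfl⟩
  have himg : L.val '' (L.val ⁻¹' (s : Set K)) = (s : Set K) :=
    Set.image_preimage_eq_of_subset hsL
  refine Subalgebra.fg_def.mpr ⟨L.val ⁻¹' (s : Set K), ?_, ?_⟩
  · exact (s.finite_toSet).preimage (hinj.injOn)
  · rw [← Subalgebra.comap_map_eq_self_of_injective hinj (Algebra.adjoin k (L.val ⁻¹' (s : Set K))),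
      AlgHom.map_adjoin, himg, hs]

/-- `Frac ((B₀ ∩ L)[τ]) = L` for `L = k(B₀, τ)`. [folklore] -/
theorem isFractionRing_adjoin_comap_val (B₀ : Subalgebra k K) (τ : K)
    (hτL : τ ∈ IntermediateField.adjoin k (insert τ (B₀ : Set K))) :
    IsFractionRing (Algebra.adjoin k (insert (⟨τ, hτL⟩ : IntermediateField.adjoin k (insert τ (B₀ : Set K)))
      ((B₀.comap (IntermediateField.adjoin k (insert τ (B₀ : Set K))).val :
        Subalgebra k (IntermediateField.adjoin k (insert τ (B₀ : Set K)))) : Set _)))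
      (IntermediateField.adjoin k (insert τ (B₀ : Set K))) := by
  classical
  set L := IntermediateField.adjoin k (insert τ (B₀ : Set K)) with hL
  have hinj : Function.Injective L.val := (L.val : L →+* K).injective
  have hB₀L : B₀ ≤ L.toSubalgebra := fun b hb =>
    IntermediateField.algebra_adjoin_le_adjoin k _ (Algebra.subset_adjoin (Set.mem_insert_of_mem τ hb))
  set R : Subalgebra k L := Algebra.adjoin k (insert (⟨τ, hτL⟩ : L) ((B₀.comap L.val : Subalgebra k L) : Set L))
    with hR
  -- `val(R) = k[B₀, τ]`
  have hRmap : R.map L.val = Algebra.adjoin k (insert τ (B₀ : Set K)) := by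
    rw [hR, AlgHom.map_adjoin, Set.image_insert_eq, image_comap_val_eq L B₀ hB₀L]
    rfl
  haveI : FaithfulSMul R L :=
    (faithfulSMul_iff_algebraMap_injective R L).mpr Subtype.val_injective
  refine IsFractionRing.of_field R L fun z => ?_
  obtain ⟨a, ha, b, hb, hz⟩ := IntermediateField.mem_adjoin_iff_div.mp z.2
  rw [← hRmap] at ha hb
  obtain ⟨a', ha', rfl⟩ := Subalgebra.mem_map.mp ha
  obtain ⟨b', hb', rfl⟩ := Subalgebra.mem_map.mp hb
  refine ⟨⟨a', ha'⟩, ⟨b', hb'⟩, hinj ?_⟩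
  rw [map_div₀]
  exact hz

/-- Transport of regularity at the centre along an equality of subalgebras. [folklore] -/
theorem isRegularLocalRing_centre_congr (O : ValuationSubring K) {S₁ S₂ : Subalgebra k K} (E : S₁ = S₂)
    (h₁ : S₁.toSubring ≤ O.toSubring) (h₂ : S₂.toSubring ≤ O.toSubring)
    (H : IsRegularLocalRing (Localization.AtPrime
      (Ideal.comap (Subring.inclusion h₂) (IsLocalRing.maximalIdeal O)))) :
    IsRegularLocalRing (Localization.AtPrime
      (Ideal.comap (Subring.inclusion h₁) (IsLocalRing.maximalIdeal O))) := by
  subst E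
  exact H

/-- **`Concl` of a cylinder datum follows from torsor LU below** (res-L0-w41-idea-2's `concl_of_cylinder`; the
sub-datum given inside `K`). Let `O` be a valuation ring of `K`, zero-dimensional over `k`; `B₀ ⊆ O` a finitely
generated `k`-subalgebra, regular at the centre of `O`, and `τ ∈ K` with `τ ^ p ∈ B₀`; put `L := k(B₀, τ)` and
assume `trdeg_k L < n`. Let `y₁, …, yₘ ∈ O` with `trdeg_k L + m ≤ trdeg_k K` (the CYLINDER directions). Then every
datum `(O, A₀, t)` with `A₀ ⊆ B₀[y]`, `t ∈ B₀[τ][y]` and `Frac (A₀[t]) = K` satisfies `Concl O A₀ t`, provided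
`TorsorLUZeroDimBelow p n`. (Instance on the W4.1 desk, paper level: in characteristic `3`, for tri-2's
`t³ = (y₂ - y₁²)² + y₃y₄ + y₁³` take `B₀ = k[y₂ - y₁², y₃, y₄]`, `τ = t - y₁`, `m = 1`, `y = (y₁)`; for the
`y₄`-free radicands take `y = (y₄)`.) [folklore] -/
theorem concl_of_cylinder {p n : ℕ} (hBelow : TorsorLUZeroDimBelow p n) [CharP k p] [PerfectField k]
    (O : ValuationSubring K) (hO : ZeroDim k O)
    (B₀ : Subalgebra k K) (h₀ : B₀.toSubring ≤ O.toSubring) (hB₀ : B₀.FG) (τ : K) (hτp : τ ^ p ∈ B₀)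
    (hreg₀ : IsRegularLocalRing (Localization.AtPrime
      (Ideal.comap (Subring.inclusion h₀) (IsLocalRing.maximalIdeal O))))
    (hn : Algebra.trdeg k (IntermediateField.adjoin k (insert τ (B₀ : Set K))) < (n : Cardinal))
    {m : ℕ} (y : Fin m → K) (hyO : ∀ i, y i ∈ O)
    (hdim : Algebra.trdeg k (IntermediateField.adjoin k (insert τ (B₀ : Set K))) + m ≤ Algebra.trdeg k K)
    (A₀ : Subalgebra k K) (hA₀ : A₀ ≤ Algebra.adjoin k ((B₀ : Set K) ∪ Set.range y))
    (t : K) (ht : t ∈ Algebra.adjoin k (insert τ ((B₀ : Set K) ∪ Set.range y)))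
    (hfrac : IsFractionRing (Algebra.adjoin k (insert t (A₀ : Set K))) K) :
    Concl O A₀ t := by
  classical
  set L := IntermediateField.adjoin k (insert τ (B₀ : Set K)) with hL
  have hτL : τ ∈ L := IntermediateField.subset_adjoin k _ (Set.mem_insert τ _)
  have hB₀L : B₀ ≤ L.toSubalgebra := fun b hb =>
    IntermediateField.algebra_adjoin_le_adjoin k _ (Algebra.subset_adjoin (Set.mem_insert_of_mem τ hb))
  -- the restricted valuation ring and the pulled-back sub-datum
  have hOL : ∀ x, x ∈ restrict O L ↔ L.val x ∈ O := mem_restrict_iff O L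
  set B₀L : Subalgebra k L := B₀.comap L.val with hB₀L'
  have himg : L.val '' (B₀L : Set L) = (B₀ : Set K) := image_comap_val_eq L B₀ hB₀L
  have hmap : B₀L.map L.val = B₀ := map_comap_val_eq L B₀ hB₀L
  have h₀L : B₀L.toSubring ≤ (restrict O L).toSubring := fun z hz =>
    (hOL z).mpr (h₀ ((Subalgebra.mem_comap _ _ _).mp hz))
  have hB₀Lfg : B₀L.FG := fg_comap_val L B₀ hB₀L hB₀
  have hτLp : (⟨τ, hτL⟩ : L) ^ p ∈ B₀L := by
    rw [Subalgebra.mem_comap, map_pow]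
    exact hτp
  have hfracL := isFractionRing_adjoin_comap_val B₀ τ hτL
  -- regularity of the pulled-back sub-datum at the centre of `O ∩ L`
  have hB' : (B₀L.map L.val).toSubring ≤ O.toSubring := by
    rw [hmap]
    exact h₀
  have hregL : IsRegularLocalRing (Localization.AtPrime
      (Ideal.comap (Subring.inclusion h₀L) (IsLocalRing.maximalIdeal (restrict O L)))) :=
    (isRegularLocalRing_centre_map_iff L.val (restrict O L) O hOL B₀L h₀L hB').mp
      (isRegularLocalRing_centre_congr O hmap hB' h₀ hreg₀)
  -- the datum lies over the cylinder
  have hA₀' : A₀ ≤ Algebra.adjoin k (L.val '' (B₀L : Set L) ∪ Set.range y) := by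
    rw [himg]
    exact hA₀
  have ht' : t ∈ Algebra.adjoin k (insert (L.val ⟨τ, hτL⟩) (L.val '' (B₀L : Set L) ∪ Set.range y)) := by
    rw [himg]
    exact ht
  exact concl_of_subdatum hBelow L.val O hO (restrict O L) hOL B₀L h₀L hB₀Lfg ⟨τ, hτL⟩ hτLp hfracL
    hregL hn y hyO hdim A₀ hA₀' t ht' hfrac

end Subfield

end Summit.ResolutionOfSingularities.ResolutionOfSingularities.Theorems.SteerCylinder
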